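import Literature.AnabelianGeometry.SemiGraphs.BTempQDPairHomHatGenProofs
import Literature.AnabelianGeometry.SemiGraphs.BTempQDPairSigmaDomination
import Literature.AnabelianGeometry.SemiGraphs.QuasiTemperoidsQDPairFunctor
import HarnessLib

/-!
# Semi-graphs of anabelioids, Appendix, proof of Theorem A.4: the category `P_i` on ALL QD-pairs
# of `B^temp(Π)` and the equivalence `P_i ⥲ T_i`

Mochizuki, *Semi-graphs of anabelioids*, Publ. RIMS **42** (2006) 221–322, Appendix, proof of
Theorem A.4, manuscript p. 85 (PRIMS p. 315 ll. 1–12)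
[cite: MochizukiSemiAnbd2006, Thm A.4 proof p.85]: "Thus, in summary, if we write `P_i` for the
category whose objects are the objects of `D_i` and whose morphisms are given by the `Hom^`'s, then
we obtain natural functors `Q_i → D_i → P_i ⥲ T_i` — i.e., the first functor maps an object `B` of
`Q_i` to the QD-pair `(B, {1})`; the second functor arises from the construction of `P_i`; the third
functor is the equivalence induced by the natural functor `D_i → T_i` considered above."

Row **A4-lim-P-full** of `plan/L3/SUBDAG-SemiAnbd-Cor311.md` (seat abc-iut-w4-d089; the strongly
connected CORE `PCore κ ≌ (B^temp(Π))⁰` is abc-iut-w4-d081's `BTempQDPairCategoryP.lean`, whose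
pattern — composition law as a parameter, unique by injectivity of `Hom^ → Hom_T` — is followed here
verbatim), for the model temperoid `T = B^temp(Π)` and `Q = T = T[Π/Π]` (so `D` = all QD-pairs of
`B^temp(Π)`), with morphisms the `Hom^` of ARBITRARY pairs `QDPair.HomHatGen`
(`BTempQDPairHomHatGen.lean`):

* `QDPair.HomHatGenCompLaw` — a composition law on `Hom^` for ALL pairs compatible with `q`
  (`toHom (x ≫ y) = toHom x ≫ toHom y`); `HomHatGenCompLaw.unique` (at most one, `toHom_injective`),
  `HomHatGenCompLaw.transported hG` (one exists for `Π` tempered, `toHom_bijective`);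
* **`QDPair.PGen κ`** — THE category `P`: objects = ALL QD-pairs `(B, Γ_B)` of `B^temp(Π)`, morphisms
  `Hom^((B, Γ_B), (C, Γ_C)) = HomHatGen`, identities `ofHom (𝟙)` ("the natural map from `Hom` to
  `Hom^`"), composition `κ`; a category (laws through the injection into `T`);
* **`PGen.toT κ : PGen κ ⥤ B^temp(Π)`**, `(B, Γ_B) ↦ B/Γ_B`, `y ↦ toHom y` — FAITHFUL (any `Π`), FULL
  (`Π` tempered) and ESSENTIALLY SURJECTIVE (`B ≅ q(B, {1})`), hence **`PGen.equivBTemp κ hG :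
  PGen κ ≌ B^temp(Π)`** — "the third functor is the equivalence `P_i ⥲ T_i`", on ALL objects;
* **`PGen.ofD κ : D ⥤ PGen κ`** — "the second functor", identity on objects, `f ↦ ofHom f`, with
  `PGen.ofDCompToTIso : ofD ⋙ toT ≅ q` (`QDPair.orbitQuotientFunctor`); `PGen.ofQ`, `ofQCompToTIso`
  — the whole chain `Q → D → P ⥲ T` composes to the identity of `T = Q`;
* the `D_i`-SCOPE (`Q_i = T_i[A_i]`, `A_i = Π/K`): **`PGen.Rel κ K`** = the full subcategory of `P`
  on the QD-pairs of `T[A]` (objects of `D_i`), `PGen.toTRel : Rel κ K ⥤ B^temp(Π)` and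
  **`PGen.equivBTempRel κ K hG hK : Rel κ K ≌ B^temp(Π)`** — "`P_i ⥲ T_i`" verbatim (all objects of
  `D_i`, all objects of `T_i`; essential surjectivity = "`q_i` is essentially surjective" in print's
  scope, abc-iut-w5-d129's `QDPair.exists_rel_orbitQuotient_iso`), with `PGen.ofDRel : D_i ⥤ Rel κ K`
  (abc-iut-w4-d110's `QDPair.mapFunctor` along `T[A] ⊆ T`, as in abc-iut-w4-d081's `PCore.ofDRel`).

The intrinsic composition of print (components of fibre products, row A4-lim-comp, abc-iut-w5-d220)
instantiates `κ` and is then equal to the transported law.  Elementary; nothing refers to the IUT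
corpus; no side is taken on any disputed claim.
-/

open CategoryTheory

namespace Literature.AnabelianGeometry.SemiGraphs

open Literature.AlgebraicGeometry.Frobenioids.QuasiTemperoid (BTempRel admitsHomToCoset)

universe u

variable {G : Type u} [Group G] [TopologicalSpace G] [IsTopologicalGroup G]

namespace QDPair

/-! ### Composition laws on `Hom^` (all pairs) compatible with `q` -/

variable (G) in
/-- **A composition law on the `Hom^` of arbitrary QD-pairs of `B^temp(Π)` compatible with composition
of arrows**: `toHom (x ≫ y) = toHom x ≫ toHom y`.  PARAMETER (print's intrinsic law is row
A4-lim-comp; unique by `HomHatGenCompLaw.unique`). [cite: MochizukiSemiAnbd2006, Thm A.4 proof pp.84-85] -/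
structure HomHatGenCompLaw : Type (u + 1) where
  /-- the composition `(x, y) ↦ x ≫ y` on `Hom^` -/
  comp : ∀ {P₁ P₂ P₃ : QDPair (BTemp G)}, HomHatGen P₁ P₂ → HomHatGen P₂ P₃ → HomHatGen P₁ P₃
  /-- compatibility with composition of arrows: `q(x ≫ y) = q(x) ≫ q(y)` -/
  toHom_comp : ∀ {P₁ P₂ P₃ : QDPair (BTemp G)} (x : HomHatGen P₁ P₂) (y : HomHatGen P₂ P₃),
    HomHatGen.toHom (comp x y) = HomHatGen.toHom x ≫ HomHatGen.toHom y

namespace HomHatGenCompLaw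

/-- **Any two composition laws compatible with `q` agree** (`HomHatGen.toHom_injective`).
[cite: MochizukiSemiAnbd2006, Thm A.4 proof pp.84-85] -/
theorem comp_eq (κ κ' : HomHatGenCompLaw G) {P₁ P₂ P₃ : QDPair (BTemp G)} (x : HomHatGen P₁ P₂)
    (y : HomHatGen P₂ P₃) : κ.comp x y = κ'.comp x y :=
  HomHatGen.toHom_injective (by rw [κ.toHom_comp, κ'.toHom_comp])

/-- Hence there is AT MOST ONE composition law on `Hom^` compatible with `q`.
[cite: MochizukiSemiAnbd2006, Thm A.4 proof pp.84-85] -/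
protected theorem unique (κ κ' : HomHatGenCompLaw G) : κ = κ' := by
  obtain ⟨c, hc⟩ := κ
  obtain ⟨c', hc'⟩ := κ'
  have h : @c = @c' := by
    funext P₁ P₂ P₃ x y
    exact HomHatGen.toHom_injective (by rw [hc, hc'])
  cases h
  rfl

/-- **Non-vacuity: for `Π` tempered a composition law compatible with `q` EXISTS** — the one
transported along the bijections `Hom^((B, Γ_B), (C, Γ_C)) ≅ Hom_T(B/Γ_B, C/Γ_C)`
(`HomHatGen.toHom_bijective`); equal to print's law by `unique`.
[cite: MochizukiSemiAnbd2006, Thm A.4 proof pp.84-85] -/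
noncomputable def transported (hG : IsTempered G) : HomHatGenCompLaw G where
  comp x y := (HomHatGen.toHom_surjective hG (HomHatGen.toHom x ≫ HomHatGen.toHom y)).choose
  toHom_comp x y :=
    (HomHatGen.toHom_surjective hG (HomHatGen.toHom x ≫ HomHatGen.toHom y)).choose_spec

end HomHatGenCompLaw

/-! ### The category `P` on all QD-pairs -/

/-- **The category `P_i`** — "whose objects are the objects of `D_i` [ALL QD-pairs `(B, Γ_B)`] and
whose morphisms are given by the `Hom^`'s"; composition the law `κ`.
[cite: MochizukiSemiAnbd2006, Thm A.4 proof p.85] -/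
structure PGen (κ : HomHatGenCompLaw G) : Type (u + 1) where
  /-- the underlying QD-pair `(B, Γ_B)` -/
  pair : QDPair (BTemp G)

namespace PGen

variable {κ : HomHatGenCompLaw G}

/-- Morphisms of `P`: `Hom^((B, Γ_B), (C, Γ_C))` for arbitrary pairs. [cite: MochizukiSemiAnbd2006, Thm A.4 proof p.85] -/
def Hom (P C : PGen κ) : Type (u + 1) := HomHatGen P.pair C.pair

/-- The identity of `P` at `(B, Γ_B)`: the natural image of `𝟙_{(B, Γ_B)}` ("the natural map from
`Hom` to `Hom^`"). [cite: MochizukiSemiAnbd2006, Thm A.4 proof p.85] -/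
def idGen (P : PGen κ) : Hom P P := HomHatGen.ofHom (𝟙 P.pair)

/-- Composition of `P`: the law `κ`. [cite: MochizukiSemiAnbd2006, Thm A.4 proof p.85] -/
def compGen {P₁ P₂ P₃ : PGen κ} (x : Hom P₁ P₂) (y : Hom P₂ P₃) : Hom P₁ P₃ := κ.comp x y

/-- `q` of the identity is the identity of `B/Γ_B`. [cite: MochizukiSemiAnbd2006, Thm A.4 proof p.85] -/
theorem toHom_idGen (P : PGen κ) : HomHatGen.toHom (idGen P) = 𝟙 P.pair.orbitQuotient := by
  rw [idGen, HomHatGen.toHom_ofHom]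
  exact (orbitQuotientFunctor (G := G)).map_id P.pair

/-- `q` is multiplicative on `P`. [cite: MochizukiSemiAnbd2006, Thm A.4 proof p.85] -/
theorem toHom_compGen {P₁ P₂ P₃ : PGen κ} (x : Hom P₁ P₂) (y : Hom P₂ P₃) :
    HomHatGen.toHom (compGen x y) = HomHatGen.toHom x ≫ HomHatGen.toHom y :=
  κ.toHom_comp x y

/-- **`P` is a category** (unit and associativity laws transported back from `T` along the injective
comparison `Hom^ → Hom_T`). [cite: MochizukiSemiAnbd2006, Thm A.4 proof p.85] -/
instance category (κ : HomHatGenCompLaw G) : Category.{u + 1} (PGen κ) where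
  Hom := Hom
  id := idGen
  comp := compGen
  id_comp f := HomHatGen.toHom_injective (by rw [toHom_compGen, toHom_idGen, Category.id_comp])
  comp_id f := HomHatGen.toHom_injective (by rw [toHom_compGen, toHom_idGen, Category.comp_id])
  assoc f g h := HomHatGen.toHom_injective (by
    rw [toHom_compGen, toHom_compGen, toHom_compGen, toHom_compGen, Category.assoc])

/-! ### The functor `P → T` and the equivalence `P ⥲ T` -/

variable (κ)

/-- **The functor `P → T = B^temp(Π)`** induced by `q`: `(B, Γ_B) ↦ B/Γ_B`, `y ↦ toHom y`.
[cite: MochizukiSemiAnbd2006, Thm A.4 proof p.85] -/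
noncomputable def toT : PGen κ ⥤ BTemp G where
  obj P := P.pair.orbitQuotient
  map f := HomHatGen.toHom f
  map_id P := toHom_idGen P
  map_comp f g := toHom_compGen f g

/-- `P → T` on morphisms is the comparison map. [cite: MochizukiSemiAnbd2006, Thm A.4 proof p.85] -/
theorem toT_map {P C : PGen κ} (x : P ⟶ C) : (toT κ).map x = HomHatGen.toHom x := rfl

/-- **`P → T` is faithful** (any `Π`). [cite: MochizukiSemiAnbd2006, Thm A.4 proof p.85] -/
instance faithful_toT : (toT κ).Faithful :=
  ⟨fun {_ _} => HomHatGen.toHom_injective⟩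

/-- **`P → T` is full** for `Π` tempered. [cite: MochizukiSemiAnbd2006, Thm A.4 proof p.85] -/
theorem full_toT (hG : IsTempered G) : (toT κ).Full :=
  ⟨fun {_ _} => HomHatGen.toHom_surjective hG⟩

/-- **`P → T` is essentially surjective**: `B ≅ q((B, {1}))` ("`q_i` is essentially surjective").
[cite: MochizukiSemiAnbd2006, Thm A.4 proof pp.83, 85] -/
instance essSurj_toT : (toT κ).EssSurj where
  mem_essImage X := by
    haveI := isIso_orbitQuotientπ_trivialPair X
    exact ⟨⟨trivialPair X⟩, ⟨(asIso (trivialPair X).orbitQuotientπ).symm⟩⟩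

/-- **`P → T` is an equivalence of categories** (faithful, full, essentially surjective), `Π`
tempered. [cite: MochizukiSemiAnbd2006, Thm A.4 proof p.85] -/
theorem isEquivalence_toT (hG : IsTempered G) : (toT κ).IsEquivalence :=
  { faithful := faithful_toT κ, full := full_toT κ hG, essSurj := essSurj_toT κ }

/-- **"The third functor is the equivalence `P_i ⥲ T_i` induced by the natural functor `D_i → T_i`"**
— for `T = B^temp(Π)`, `Π` tempered, on ALL objects. [cite: MochizukiSemiAnbd2006, Thm A.4 proof p.85] -/
noncomputable def equivBTemp (hG : IsTempered G) : PGen κ ≌ BTemp G :=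
  haveI := isEquivalence_toT κ hG
  (toT κ).asEquivalence

/-- The equivalence is `P → T`. [cite: MochizukiSemiAnbd2006, Thm A.4 proof p.85] -/
theorem equivBTemp_functor (hG : IsTempered G) : (equivBTemp κ hG).functor = toT κ := rfl

/-- **`P ⥲ T` with no parameter left**: for `Π` tempered, `P` on the (unique) transported law is
equivalent to `B^temp(Π)`. [cite: MochizukiSemiAnbd2006, Thm A.4 proof p.85] -/
noncomputable def equivBTempTransported (hG : IsTempered G) :
    PGen (HomHatGenCompLaw.transported hG) ≌ BTemp G :=
  equivBTemp _ hG

/-! ### The functor `D → P` -/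

/-- **"The second functor `D_i → P_i` arises from the construction of `P_i`"**: identity on objects,
`f ↦ ofHom f` (the natural map `Hom → Hom^`); functorial because `q` is and `Hom^ → Hom_T` is
injective. [cite: MochizukiSemiAnbd2006, Thm A.4 proof p.85] -/
noncomputable def ofD : QDPair (BTemp G) ⥤ PGen κ where
  obj P := ⟨P⟩
  map f := (HomHatGen.ofHom f : HomHatGen _ _)
  map_id _ := rfl
  map_comp f g := HomHatGen.toHom_injective (by
    change HomHatGen.toHom (HomHatGen.ofHom (f ≫ g)) =
      HomHatGen.toHom (κ.comp (HomHatGen.ofHom f) (HomHatGen.ofHom g))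
    rw [κ.toHom_comp, HomHatGen.toHom_ofHom, HomHatGen.toHom_ofHom, HomHatGen.toHom_ofHom]
    exact (orbitQuotientFunctor (G := G)).map_comp f g)

/-- `D → P → T` on morphisms is `q`: `toHom (ofHom f) = q(f)`. [cite: MochizukiSemiAnbd2006, Thm A.4 proof p.85] -/
theorem toT_map_ofD_map {P C : QDPair (BTemp G)} (f : P ⟶ C) :
    (toT κ).map ((ofD κ).map f) = orbitQuotientMap f :=
  HomHatGen.toHom_ofHom f

/-- **`D → P → T` is (isomorphic, with identity components, to) the natural functor `q : D → T`,
`(B, Γ_B) ↦ B/Γ_B`**. [cite: MochizukiSemiAnbd2006, Thm A.4 proof p.85] -/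
noncomputable def ofDCompToTIso : ofD κ ⋙ toT κ ≅ orbitQuotientFunctor :=
  NatIso.ofComponents (fun _ => Iso.refl _) fun f => by
    change (toT κ).map ((ofD κ).map f) ≫ 𝟙 _ = 𝟙 _ ≫ orbitQuotientMap f
    rw [Category.comp_id, Category.id_comp, toT_map_ofD_map]

/-- **"The first functor maps an object `B` of `Q_i` to the QD-pair `(B, {1})`"** (abc-iut-w4-d110's
`QDPair.trivialPairFunctor`) composed with `D → P`: `Q = T → P`, `B ↦ (B, {1})`.
[cite: MochizukiSemiAnbd2006, Thm A.4 proof p.85] -/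
noncomputable def ofQ : BTemp G ⥤ PGen κ := trivialPairFunctor (BTemp G) ⋙ ofD κ

/-- `Q → P → T ≅ 𝟙`: `B ↦ q(B, {1}) ≅ B` naturally (the class map `B → B/{1}` is an isomorphism) —
the composite `Q_i → D_i → P_i ⥲ T_i` is (isomorphic to) the identity of `T = Q`.
[cite: MochizukiSemiAnbd2006, Thm A.4 proof p.85] -/
noncomputable def ofQCompToTIso : ofQ κ ⋙ toT κ ≅ 𝟭 (BTemp G) :=
  (NatIso.ofComponents
    (fun X => @asIso _ _ _ _ (trivialPair X).orbitQuotientπ (isIso_orbitQuotientπ_trivialPair X))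
    (fun {X Y} f => by
      have h1 : (toT κ).map ((ofD κ).map ((trivialPairFunctor (BTemp G)).map f)) =
          orbitQuotientMap ((trivialPairFunctor (BTemp G)).map f) := toT_map_ofD_map κ _
      have h2 := orbitQuotientπ_map ((trivialPairFunctor (BTemp G)).map f)
      have h3 := congrArg (fun m => (trivialPair X).orbitQuotientπ ≫ m) h1
      exact (h3.trans h2).symm)).symm

/-! ### `D_i`-scope: QD-pairs of `Q_i = T_i[A_i]`, `A_i = Π/K`, and `P_i ⥲ T_i` verbatim -/

section Rel

variable (K : Subgroup G)

/-- The objects of `D_i` among those of `P`: QD-pairs `(B, Γ_B)` with `B` admitting an arrow to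
`A = Π/K`, i.e. QD-pairs of `Q_i = T[A] = B^temp(Π)[Π/K]`. [cite: MochizukiSemiAnbd2006, Thm A.4 proof p.83] -/
def inScope : ObjectProperty (PGen κ) := fun P => admitsHomToCoset G K P.pair.A

/-- **`P_i` in the scope of `D_i`**: the full subcategory of `PGen κ` on the QD-pairs of `T[A]`,
`A = Π/K` ("the category whose objects are the objects of `D_i` and whose morphisms are given by the
`Hom^`'s"). [cite: MochizukiSemiAnbd2006, Thm A.4 proof p.85] -/
abbrev Rel : Type (u + 1) := (inScope κ K).FullSubcategory

/-- The functor `P_i → T_i` in `D_i`-scope: `(B, Γ_B) ↦ B/Γ_B`, `y ↦ toHom y`.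
[cite: MochizukiSemiAnbd2006, Thm A.4 proof p.85] -/
noncomputable def toTRel : Rel κ K ⥤ BTemp G := (inScope κ K).ι ⋙ toT κ

/-- `P_i → T_i` (scoped) on objects. [cite: MochizukiSemiAnbd2006, Thm A.4 proof p.85] -/
theorem toTRel_obj (P : Rel κ K) : (toTRel κ K).obj P = P.obj.pair.orbitQuotient := rfl

/-- `P_i → T_i` (scoped) is faithful. [cite: MochizukiSemiAnbd2006, Thm A.4 proof p.85] -/
instance faithful_toTRel : (toTRel κ K).Faithful := by
  unfold toTRel; infer_instance

/-- `P_i → T_i` (scoped) is full, `Π` tempered. [cite: MochizukiSemiAnbd2006, Thm A.4 proof p.85] -/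
theorem full_toTRel (hG : IsTempered G) : (toTRel κ K).Full := by
  haveI := full_toT κ hG
  unfold toTRel; infer_instance

/-- **`P_i → T_i` (scoped) is essentially surjective** — "`q_i` is essentially surjective" in print's
scope: every object of `T_i` is `≅ B/Γ_B` for a QD-pair `(B, Γ_B)` OF `D_i` (`Π` tempered, `K` open;
abc-iut-w5-d129's `exists_rel_orbitQuotient_iso`). [cite: MochizukiSemiAnbd2006, Thm A.4 proof p.83] -/
theorem essSurj_toTRel (hG : IsTempered G) (hK : IsOpen (K : Set G)) : (toTRel κ K).EssSurj :=
  ⟨fun X => by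
    obtain ⟨P, hPA, ⟨e⟩⟩ := exists_rel_orbitQuotient_iso hG hK X
    exact ⟨⟨⟨P⟩, hPA⟩, ⟨e⟩⟩⟩

/-- `P_i → T_i` (scoped) is an equivalence of categories, `Π` tempered, `K` open.
[cite: MochizukiSemiAnbd2006, Thm A.4 proof p.85] -/
theorem isEquivalence_toTRel (hG : IsTempered G) (hK : IsOpen (K : Set G)) :
    (toTRel κ K).IsEquivalence :=
  { faithful := faithful_toTRel κ K, full := full_toTRel κ K hG, essSurj := essSurj_toTRel κ K hG hK }

/-- **"the third functor is the equivalence `P_i ⥲ T_i` induced by the natural functor `D_i → T_i`"**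
— VERBATIM for the model: `P_i` = all QD-pairs of `Q_i = T_i[A_i]` with the `Hom^`'s, `T_i =
B^temp(Π)`, `A_i = Π/K` (`Π` tempered, `K` open). [cite: MochizukiSemiAnbd2006, Thm A.4 proof p.85] -/
noncomputable def equivBTempRel (hG : IsTempered G) (hK : IsOpen (K : Set G)) : Rel κ K ≌ BTemp G :=
  haveI := isEquivalence_toTRel κ K hG hK
  (toTRel κ K).asEquivalence

/-- The equivalence is the scoped `P_i → T_i`. [cite: MochizukiSemiAnbd2006, Thm A.4 proof p.85] -/
theorem equivBTempRel_functor (hG : IsTempered G) (hK : IsOpen (K : Set G)) :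
    (equivBTempRel κ K hG hK).functor = toTRel κ K := rfl

/-- **"the second functor `D_i → P_i`"** in scope: a QD-pair of `T[A] = BTempRel Π K` goes to its
underlying QD-pair of `T` (abc-iut-w4-d110's `QDPair.mapFunctor` along the full inclusion), which is
in scope; arrows go to `ofHom`. [cite: MochizukiSemiAnbd2006, Thm A.4 proof p.85] -/
noncomputable def ofDRel : QDPair (BTempRel G K) ⥤ Rel κ K :=
  (inScope κ K).lift (mapFunctor (admitsHomToCoset G K).ι ⋙ ofD κ) fun P => P.A.property

/-- `D_i → P_i → T_i` (scoped) on objects is `q` of the underlying QD-pair of `T`.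
[cite: MochizukiSemiAnbd2006, Thm A.4 proof p.85] -/
theorem toTRel_obj_ofDRel_obj (P : QDPair (BTempRel G K)) :
    (toTRel κ K).obj ((ofDRel κ K).obj P) =
      ((mapFunctor (admitsHomToCoset G K).ι).obj P).orbitQuotient := rfl

/-- `D_i → P_i → T_i` (scoped) on arrows is `q` of the underlying arrow of `T`.
[cite: MochizukiSemiAnbd2006, Thm A.4 proof p.85] -/
theorem toTRel_map_ofDRel_map {P C : QDPair (BTempRel G K)} (f : P ⟶ C) :
    (toTRel κ K).map ((ofDRel κ K).map f) =
      orbitQuotientMap ((mapFunctor (admitsHomToCoset G K).ι).map f) :=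
  toT_map_ofD_map κ ((mapFunctor (admitsHomToCoset G K).ι).map f)

end Rel

end PGen

end QDPair

end Literature.AnabelianGeometry.SemiGraphs
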